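import Summits.HodgeConjecture.HodgeConjecture.Theorems.Ring2HypothesesDescentMotivatedStarStable
import Summits.HodgeConjecture.HodgeConjecture.Theorems.Ring2AbelianAllAndreHodgeNondegenerate
import Summits.HodgeConjecture.HodgeConjecture.Theorems.Ring2AbelianAllAndreStandardANumerical
import Literature.AlgebraicGeometry.HodgeTheory.MotivatedClassesRationalSpan
import HarnessLib

/-!
# Ring 2 hypotheses, descent face — André's Prop. 3.3 on the real carriers: «≡ est l'égalité sur A_mot(X)» —
# homological and numerical equivalence coincide on motivated classes (the cup pairing
# `A_motᵖ(X)_ℂ × A_mot^{n-p}(X)_ℂ → H^{2n}` is non-degenerate), unconditionally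

research route conditional on HC_CM; not a corollary; Q11.4-sentence-2 already refuted in dim ≥ 3.
Cell `pub-hodge-ring2` (Hodge ladder STAGE 3), seat `ring2-b05` (binder row b05
`Ring2.Hypotheses.MotivatedImpliesAlgebraicAV`), gen 36. `HC_CM` (`Theses.RankFourFaces.CMAbelianHodge`) does
not occur in this file; nothing here proves a case of the Hodge conjecture; the row b05 stays OPEN.

André 1996, Prop. 3.3 (p. 21–22): «Supposons que `K` soit de caractéristique nulle et que `H` soit une cohomologie
classique … Alors `Q = ℚ`, et `≡` est l'égalité sur `A_mot(X)`. La `ℚ`-algèbre `C_mot(X, X)` est semi-simple de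
dimension finie. … Preuve. … Le théorème de l'indice de Hodge entraîne que `(x, y) ↦ ⟨x ∪ *_H y⟩` définit un produit
scalaire sur les cycles motivés (car ceux-ci sont clairement de type `(p,p)`). Comme `*_H` est un automorphisme de
`A_mot(X)` (prop. 4), la forme `(x, y) ↦ ⟨x ∪ y⟩` est donc non dégénérée sur `A_mot(X)`, c'est-à-dire que `≡` est
l'égalité.» Here `≡` is numerical equivalence of motivated cycles. On the real carriers the automorphism «prop. 4»
is André's Prop. 2.2 Cor. 1–2, proved in `Theorems/Ring2HypothesesDescentMotivatedStarStable` (this seat, gen 36),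
and the Hodge index input is the second Hodge–Riemann relation of the tree's Kähler–rational datum
(`KaehlerRationalDatum.cform_conj_pos`), exactly as in part XVIII-b of the AbelianAll André axis
(`Ring2.AbelianAll.eq_zero_of_forall_cupProduct_span_hodge_eq_zero`, the same for the Hodge spans).

* §1 `conjClass_mem_motivatedClasses` — `A_motᵖ(X)_ℂ` is stable under complex conjugation (it is the `ℂ`-span of its
  RATIONAL classes, André Prop. 3.2.1/3.3, the tree's `span_isRationalClass_isMotivatedClass`);
* §2 **`eq_zero_of_forall_cupProduct_motivated_eq_zero`** (left) and **`…'`** (right): for `X` smooth projective of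
  dimension `n`, `p + q = n`, a motivated class `ξ ∈ A_motᵖ(X)_ℂ` cup-orthogonal to `A_mot^q(X)_ℂ` vanishes —
  `Q_D(conj ξ, ξ) = τ(z ∪ ξ)` with `z ∈ A_mot^q` built from the Lefschetz terms `L^{n-a-t} ξ_P(conj ξ)`, which are
  MOTIVATED by Prop. 2.2 Cor. 2 (`lefschetzPowTo_primitivePart_mem_motivatedClasses`); `nondegenerate_motivatedClasses`
  packages both sides. For ALGEBRAIC classes the same statement is Grothendieck's conjecture `D(X)` (open; the tree's
  `Ring2.AbelianAll.nondegenerate_algebraicClasses_of_standardConjectureA` derives it from `A(X)`); for motivated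
  classes it is a theorem.
* §3 `finrank_motivatedClasses_eq` — `dim A_motᵖ(X)_ℂ = dim A_mot^{n-p}(X)_ℂ` (`*_η` is a bijection, Cor. 1).

No definition, no named fact, no sorry. References: Andre1996Motifs (Prop. 3.3 pp. 21–22, Prop. 3.2.1 p. 20,
Prop. 2.2 Cor. 1–2 p. 16), Kleiman1968AlgebraicCycles (§3, Prop. 3.8, Cor. 3.9, 3.11), VoisinHodgeI2002 (§6.3.2
Thm. 6.32, §7.1.2), Grothendieck1968 (§3 p. 196, D(X)).
-/

noncomputable section

-- every declaration of this problem lives in `Summit.HodgeConjecture.HodgeConjecture.…` (summit = sub-problem)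
set_option linter.dupNamespace false

open CategoryTheory AlgebraicGeometry MonoidalCategory CartesianMonoidalCategory
open Literature.AlgebraicTopology.SingularHomology Literature.Geometry.Kaehler
open Literature.AlgebraicGeometry Literature.AlgebraicGeometry.Motives
  Literature.AlgebraicGeometry.HodgeTheory

namespace Summit.HodgeConjecture.HodgeConjecture.Theorems

variable {n : ℕ} {X : SchemeOver ℂ}

/-! ## §1 `A_mot(X)_ℂ` is stable under complex conjugation -/

/-- **`A_motᵖ(X)_ℂ` is stable under complex conjugation**: it is the `ℂ`-span of its rational classes (André
Prop. 3.2.1 with Prop. 3.3, the tree's `span_isRationalClass_isMotivatedClass`), and rational classes are real.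
[cite: Andre1996Motifs, Prop. 3.2.1 (p. 20) and Prop. 3.3 (p. 21)] [cite: VoisinHodgeI2002, Cor. 6.12] -/
theorem conjClass_mem_motivatedClasses (hX : IsSmoothProjective n X) (p : ℕ) {c : complexBetti X (2 * p)}
    (hc : c ∈ motivatedClasses n X p) : conjClass (ComplexPoints X) (2 * p) c ∈ motivatedClasses n X p := by
  rw [← span_isRationalClass_isMotivatedClass hX p] at hc ⊢
  induction hc using Submodule.span_induction with
  | mem c hmem => rw [hmem.1.conjClass_eq]; exact Submodule.subset_span hmem
  | zero => rw [conjClass_zero]; exact Submodule.zero_mem _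
  | add c c' _ _ ihc ihc' => rw [conjClass_add]; exact Submodule.add_mem _ ihc ihc'
  | smul a c _ ihc => rw [conjClass_smul]; exact Submodule.smul_mem _ _ ihc

/-! ## §2 «≡ est l'égalité sur `A_mot(X)`»: the cup pairing is non-degenerate on motivated classes -/

/-- **LEFT NON-DEGENERACY OF THE CUP PAIRING ON MOTIVATED CLASSES (André 1996, Prop. 3.3: homological = numerical
equivalence on `A_mot(X)`).** For `X` smooth projective of dimension `n`, `p + q = n`, and `ξ ∈ A_motᵖ(X)_ℂ`: if
`ξ ∪ h = 0` for every `h ∈ A_mot^q(X)_ℂ`, then `ξ = 0`. Proof (André's, on the real carriers): with a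
Kähler–rational datum `D` of `X` (Kähler class `η`, a polarisation class) and `x = conj ξ ∈ A_motᵖ`
(`conjClass_mem_motivatedClasses`), `Q_D(x, ·) = τ(z ∪ ·)` for the class `z = Σ_P ± L^{n-a-t} ξ_P x`
(`Ring2.AbelianAll.exists_polarizationForm_eq_trace_cupProduct`), which is MOTIVATED of codimension `q` by Prop. 2.2
Cor. 2 (`lefschetzPowTo_primitivePart_mem_motivatedClasses`); so `Q_D(x, conj x) = ± τ(ξ ∪ z) = 0`, and `x = 0` by the
second Hodge–Riemann relation for classes of pure type `(p,p)` (`KaehlerRationalDatum.cform_conj_pos`; motivated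
classes lie in the Hodge span, `Andre1996_motivatedClasses_le_span_hodgeClasses_holds`).
[cite: Andre1996Motifs, Prop. 3.3 (pp. 21–22)] [cite: Kleiman1968AlgebraicCycles, §3 Prop. 3.8 and 3.11]
[cite: VoisinHodgeI2002, §6.3.2 Thm. 6.32 and §7.1.2] -/
theorem eq_zero_of_forall_cupProduct_motivated_eq_zero (hX : IsSmoothProjective n X) {p q : ℕ} (hpq : p + q = n)
    {ξ : complexBetti X (2 * p)} (hξ : ξ ∈ motivatedClasses n X p)
    (h : ∀ h ∈ motivatedClasses n X q, cupProduct (show 2 * p + 2 * q = 2 * n by omega) ξ h = 0) :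
    ξ = 0 := by
  obtain ⟨D⟩ := nonempty_kaehlerRationalDatum hX
  obtain ⟨A⟩ := nonempty_hodgeModel_holds hX
  have hη : IsPolarizationClass n X D.Hη := Ring2.AbelianAll.isPolarizationClass_Hη hX D
  set x := conjClass (ComplexPoints X) (2 * p) ξ with hxdef
  have hx : x ∈ motivatedClasses n X p := conjClass_mem_motivatedClasses hX p hξ
  -- `Q_D(x, ·) = τ(z ∪ ·)` with `z ∈ A_mot^q` (Prop. 2.2 Cor. 2)
  obtain ⟨z, hz, hQ⟩ := Ring2.AbelianAll.exists_polarizationForm_eq_trace_cupProduct (D.hLℂ hX)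
    (subsingleton_of_lt hX ℂ) (D.cTrace hX) (show 2 * q + 2 * p = 2 * n by omega) x (motivatedClasses n X q)
    (fun P s' hs' hq' ↦ by
      obtain ⟨⟨a, t⟩, hP⟩ := P
      dsimp only at hs' hq' ⊢
      obtain ⟨q₁, rfl⟩ : ∃ q₁, a = 2 * q₁ := ⟨p - t, by omega⟩
      exact lefschetzPowTo_primitivePart_mem_motivatedClasses hX hη hx q₁ t hP s' hq')
  -- `Q_D(x, conj x) = τ(z ∪ ξ) = ± τ(ξ ∪ z) = 0`
  have h0 : D.cform hX (2 * p) x (conjClass (ComplexPoints X) (2 * p) x) = 0 := by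
    rw [hxdef, conjClass_conjClass ξ, ← hxdef, KaehlerRationalDatum.cform, hQ,
      cupProduct_gradedComm_holds ℂ (ComplexPoints X) (show 2 * q + 2 * p = 2 * n by omega)
        (show 2 * p + 2 * q = 2 * n by omega) z ξ, h z hz, smul_zero, map_zero]
  -- Hodge–Riemann: `x = 0`
  by_contra hξ0
  have hx0 : x ≠ 0 := by
    intro hx0
    apply hξ0
    rw [← conjClass_conjClass ξ, ← hxdef, hx0, conjClass_zero]
  have hpp : (p, p) ∈ Finset.HasAntidiagonal.antidiagonal (2 * p) := Finset.HasAntidiagonal.mem_antidiagonal.2 (by omega)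
  have hxA : x ∈ A.typePiece (2 * p) ⟨(p, p), hpp⟩ :=
    Ring2.AbelianAll.span_hodge_le_typePiece hX A p hpp (Andre1996_motivatedClasses_le_span_hodgeClasses_holds hX p hx)
  obtain ⟨r, hr, hQr⟩ := D.cform_conj_pos hX A hpp hxA hx0
  rw [h0, mul_zero] at hQr
  exact hr.ne' (by exact_mod_cast hQr.symm)

/-- **RIGHT NON-DEGENERACY** (the same with `p`, `q` exchanged; graded commutativity in even degrees).
[cite: Andre1996Motifs, Prop. 3.3 (pp. 21–22)] -/
theorem eq_zero_of_forall_cupProduct_motivated_eq_zero' (hX : IsSmoothProjective n X) {p q : ℕ} (hpq : p + q = n)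
    {h : complexBetti X (2 * q)} (hh : h ∈ motivatedClasses n X q)
    (h0 : ∀ ξ ∈ motivatedClasses n X p, cupProduct (show 2 * p + 2 * q = 2 * n by omega) ξ h = 0) :
    h = 0 := by
  refine eq_zero_of_forall_cupProduct_motivated_eq_zero hX (show q + p = n by omega) hh fun ξ hξ ↦ ?_
  rw [cupProduct_gradedComm_holds ℂ (ComplexPoints X) (show 2 * q + 2 * p = 2 * n by omega)
    (show 2 * p + 2 * q = 2 * n by omega) h ξ, h0 ξ hξ, smul_zero]

/-- **André 1996, Prop. 3.3 on the real carriers — «≡ est l'égalité sur `A_mot(X)`», packaged**: for every smooth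
projective complex `X` of dimension `n` and `p + q = n`, the cup product pairing
`A_motᵖ(X)_ℂ × A_mot^q(X)_ℂ → H^{2n}(X(ℂ); ℂ)` is non-degenerate on both sides — numerical and homological
equivalence agree on motivated classes, UNCONDITIONALLY. (For algebraic classes this is Grothendieck's `D(X)`, open;
the tree derives it from `A(X)` in `Ring2.AbelianAll.nondegenerate_algebraicClasses_of_standardConjectureA`.)
[cite: Andre1996Motifs, Prop. 3.3 (pp. 21–22)] [cite: Grothendieck1968, §3 p. 196] -/
theorem nondegenerate_motivatedClasses (hX : IsSmoothProjective n X) {p q : ℕ} (hpq : p + q = n) :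
    (∀ ξ ∈ motivatedClasses n X p,
        (∀ b ∈ motivatedClasses n X q, cupProduct (show 2 * p + 2 * q = 2 * n by omega) ξ b = 0) → ξ = 0) ∧
      (∀ b ∈ motivatedClasses n X q,
        (∀ ξ ∈ motivatedClasses n X p, cupProduct (show 2 * p + 2 * q = 2 * n by omega) ξ b = 0) → b = 0) :=
  ⟨fun _ hξ hb ↦ eq_zero_of_forall_cupProduct_motivated_eq_zero hX hpq hξ hb,
    fun _ hb hξ ↦ eq_zero_of_forall_cupProduct_motivated_eq_zero' hX hpq hb hξ⟩

/-! ## §3 `dim A_motᵖ(X)_ℂ = dim A_mot^{n-p}(X)_ℂ` -/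

/-- **`dim_ℂ A_motᵖ(X)_ℂ = dim_ℂ A_mot^{p'}(X)_ℂ` for `p + p' = n`**: André's `*_η` (any polarisation class `η`)
restricts to a linear bijection between the two (Prop. 2.2 Cor. 1, `map_lefschetzInvolution_motivatedClasses_eq`).
[cite: Andre1996Motifs, Prop. 2.2 Cor. 1 (p. 16) and Prop. 3.3 (p. 21)] -/
theorem finrank_motivatedClasses_eq (hX : IsSmoothProjective n X) {η : complexBetti X 2}
    (hη : IsPolarizationClass n X η) {p p' : ℕ} (hpp' : p + p' = n) :
    Module.finrank ℂ (motivatedClasses n X p) = Module.finrank ℂ (motivatedClasses n X p') := by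
  have h : 2 * p + 2 * p' = 2 * n := by omega
  rw [← map_lefschetzInvolution_motivatedClasses_eq hX hη h]
  exact LinearEquiv.finrank_eq (Submodule.equivMapOfInjective _
    (lefschetzInvolution_bijective hη.hasHardLefschetz h).1 (motivatedClasses n X p))

end Summit.HodgeConjecture.HodgeConjecture.Theorems

end
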